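import Summits.HodgeConjecture.HodgeConjecture.Theorems.F0P6aStubEHECKESocket
import HarnessLib

/-!
# `F0P6aStubEHECKEReaders` — ★ RE-HOME of `Lines/F0_P6a_StubEHECKE.lean`, PART 2 of 6 (size-lint split; cut at a declaration boundary).

## Import provenance
- `Theorems.F0P6aStubEHECKESocket` = ★ previous part of the same `Lines` workfile `F0_P6a_StubEHECKE` (size-lint split ×6); `HarnessLib`.

See PART 1 `Theorems/F0P6aStubEHECKESocket.lean` for the full re-home header and the original module docstring (verbatim there). Namespaces and sections KEPT
(re-opened below exactly as they stand at the cut, with their `open`∕`variable` lines replayed); code bytes = the workfile՚s, docstrings included; options preamble repeated from PART 1.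
HC_CM is proved only modulo the 7 printed citations (2 remaining: hLiu418 = stmt-HodgeConjecture-24832, h413 = stmt-HodgeConjecture-24833) until rung 0 closes; a re-home is count-neutral. -/

set_option autoImplicit false

noncomputable section

namespace Summit.HodgeConjecture.HodgeConjecture.Cruxes.HLiu418.F0P6aStubEHECKE
set_option linter.dupNamespace false
open CategoryTheory CategoryTheory.Limits NumberField IsDedekindDomain MulAction AlgebraicGeometry
open scoped Matrix Polynomial Pointwise
open Literature.NumberTheory.GaloisRepresentations
open Literature.NumberTheory.Automorphic Literature.NumberTheory.Automorphic.UnitaryGroup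
open Literature.AlgebraicGeometry.ShimuraVarieties Literature.AlgebraicGeometry.ShimuraVarieties.UnitaryCanonicalModel
open Literature.NumberTheory.Automorphic.Liu2021.AppendixC
open Literature.AlgebraicGeometry.Motives (AlgPoints ComplexPoints SchemeOver thickeningLift specOver)
open Literature.AlgebraicGeometry.Motives.AbelianVariety (bcSpec)
open Literature.AlgebraicGeometry.AbelianSchemes (PolarizedAbelianSchemeWithLevel AbelianSchemeOver)
open Literature.AlgebraicGeometry.ModuliOfAbelianVarieties
open Summit.HodgeConjecture.HodgeConjecture.Cruxes.HLiu418.F0P6aPELWitnessE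
open Summit.HodgeConjecture.HodgeConjecture.Cruxes.HLiu418.F0P6aStubE6 (RingActionReading Reads)
open Summit.HodgeConjecture.HodgeConjecture.Cruxes.HLiu418.F0P6aEReadings (EHeckeAt HeckeRoofsE RoofE schEOf fibreEOf dualEOf polEOf lvlPtEOf actEOf IsIdealTorsionE)
open Literature.AlgebraicGeometry.AbelianSchemes.AbelianSchemeOver (fibreHom RingAction exists_pointsAlong_mulEquiv_of_eq pointsAlong_map_of_eq
  pointsAlong_forall_map_eq_one_iff_of_eq roof_readAt_comp_of_eq)
open Summit.HodgeConjecture.HodgeConjecture.Cruxes.HLiu418.F0P6aModuliDatumDefs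
open Summit.HodgeConjecture.HodgeConjecture.Cruxes.HLiu418.F0P6aRGDAssembly
open Literature.AlgebraicGeometry.Motives (CMType)
open Literature.AlgebraicGeometry.ShimuraVarieties.UnitaryCanonicalModel.Aux (ratBasis torusFinAdelic)
open Literature.AlgebraicGeometry.ShimuraVarieties.UnitaryCurve Literature.AlgebraicGeometry.ShimuraVarieties.UnitaryCurve.AuxV
open Literature.NumberTheory.ComplexMultiplication.CMTypeOps (flip bar)
open Literature.Geometry.Kaehler (ComplexTorus)
open Summit.HodgeConjecture.HodgeConjecture.Cruxes.HLiu418.F0P6aChartFramePin (IsChartOfFrame)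


set_option maxHeartbeats 400000 in
/-- **`HeckeLinesRoofsAt … e′ N′ hN′Kc rc₁ hrcN₁ x′` — THE `t₁`-HALF of `HeckeRoofsAt`**: the lines `H_β` (injective, order `q`, `𝔭_{c•w}`-torsion, `𝒪_F`-stable, exhaustive) and the
`t₁`-roofs through kernels `K_β` meeting the `𝔭_{c•w}`-torsion in `H_β` — the first four conjuncts of `HeckeRoofsAt` VERBATIM (organ (O-R1)).  NOT asserted by declaring it.
[cite: HarrisTaylorAMS2001, §III.4, pp. 108–110] [cite: Liu2021, Lemma C.18 p. 115, Prop. D.8 p. 135] -/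
def HeckeLinesRoofsAt {F : Type} [Field F] [NumberField F] [IsCMField F] {ι₁ : F →+* ℂ} {Jstar : Matrix (Fin 2) (Fin 2) F}
    {K₀ : C5.OpenCompactSubgroup ↥(finAdelic ↥(maximalRealSubfield F) F (IsCMField.complexConj F) 2 Jstar)}
    (S : RecordSystemGS F Jstar ι₁ K₀) (hU7ₛ : S.HeckeTranslateDefinedOver)
    (hJ : (Jstar.map (IsCMField.complexConj F))ᵀ = Jstar) (hJu : IsUnit Jstar)
    {Fi : Type} [Field Fi] [Algebra F Fi] (Kc : C5.SmallLevel K₀)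
    (w : HeightOneSpectrum (𝓞 F)) (hw : (IsCMField.complexConj F) • w ≠ w)
    (univ : Literature.AlgebraicGeometry.AbelianSchemes.AbelianSchemeOver ((Literature.AlgebraicGeometry.Motives.baseChange F Fi).obj (S.M.obj Kc)).left)
    (act : Literature.AlgebraicGeometry.AbelianSchemes.AbelianSchemeOver.RingAction (𝓞 F) univ)
    (dual : univ.DualPair) (pol : univ.Polarization dual) {g N : ℕ} (lvl : univ.LevelStructure g N) (pChar fDeg : ℕ)
    {Ω : Type} [Field Ω] [Algebra F Ω] (e' : Fi →ₐ[F] Ω) (N' : C5.SmallLevel K₀) (hN'Kc : N' ≤ Kc)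
    (rc₁ : orbit (Kc.1.1 : Subgroup ↥(finAdelic ↥(maximalRealSubfield F) F (IsCMField.complexConj F) 2 Jstar))
         ((UnitaryGroup.heckeElementAt ↥(maximalRealSubfield F) F (IsCMField.complexConj F) 2 Jstar
             (⟨w, rfl⟩ : UnitaryGroup.PlacesOver F (w.under (𝓞 ↥(maximalRealSubfield F))))
             (IsCMField.complexConj_ne_one F) hJ hw (UnitaryGroup.isUnit_placeForm Jstar hJu w) (HeckeCharacter.uniformizer F w) 1 :
           ↥(finAdelic ↥(maximalRealSubfield F) F (IsCMField.complexConj F) 2 Jstar)) :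
           ↥(finAdelic ↥(maximalRealSubfield F) F (IsCMField.complexConj F) 2 Jstar) ⧸
             (Kc.1.1 : Subgroup ↥(finAdelic ↥(maximalRealSubfield F) F (IsCMField.complexConj F) 2 Jstar))) →
       ↥(finAdelic ↥(maximalRealSubfield F) F (IsCMField.complexConj F) 2 Jstar))
    (hrcN₁ : ∀ β, C5.HeckeLE (rc₁ β) N' Kc)
    (x' : AlgPoints (S.M.obj N') Ω) : Prop :=
    ∃ Hβ : (orbit (Kc.1.1 : Subgroup ↥(finAdelic ↥(maximalRealSubfield F) F (IsCMField.complexConj F) 2 Jstar))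
         ((UnitaryGroup.heckeElementAt ↥(maximalRealSubfield F) F (IsCMField.complexConj F) 2 Jstar
             (⟨w, rfl⟩ : UnitaryGroup.PlacesOver F (w.under (𝓞 ↥(maximalRealSubfield F))))
             (IsCMField.complexConj_ne_one F) hJ hw (UnitaryGroup.isUnit_placeForm Jstar hJu w) (HeckeCharacter.uniformizer F w) 1 :
           ↥(finAdelic ↥(maximalRealSubfield F) F (IsCMField.complexConj F) 2 Jstar)) :
           ↥(finAdelic ↥(maximalRealSubfield F) F (IsCMField.complexConj F) 2 Jstar) ⧸
             (Kc.1.1 : Subgroup ↥(finAdelic ↥(maximalRealSubfield F) F (IsCMField.complexConj F) 2 Jstar)))) →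
        Subgroup ((fibreAt S Kc e' univ (AlgPoints.map (S.M.map (homOfLE hN'Kc)) x')).Points Ω),
      -- the lines: `H_β` runs BIJECTIVELY through the `𝒪_F`-stable order-`q` subgroups of `A_y[𝔭_{c•w}](Ω)`
      Function.Injective Hβ ∧
      (∀ β, Nat.card ↥(Hβ β) = pChar ^ fDeg ∧ (∀ P ∈ Hβ β, IsIdealTorsionAt S Kc e' univ act (AlgPoints.map (S.M.map (homOfLE hN'Kc)) x')
          ((IsCMField.complexConj F) • w).asIdeal P) ∧
        ∀ (a : 𝓞 F), ∀ P ∈ Hβ β, (AlgPoints.map (actAt S Kc e' univ act a (AlgPoints.map (S.M.map (homOfLE hN'Kc)) x')).hom.hom.hom P :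
          (fibreAt S Kc e' univ (AlgPoints.map (S.M.map (homOfLE hN'Kc)) x')).Points Ω) ∈ Hβ β) ∧
      (∀ H : Subgroup ((fibreAt S Kc e' univ (AlgPoints.map (S.M.map (homOfLE hN'Kc)) x')).Points Ω),
        Nat.card ↥H = pChar ^ fDeg → (∀ P ∈ H, IsIdealTorsionAt S Kc e' univ act (AlgPoints.map (S.M.map (homOfLE hN'Kc)) x')
          ((IsCMField.complexConj F) • w).asIdeal P) →
        (∀ (a : 𝓞 F), ∀ P ∈ H, (AlgPoints.map (actAt S Kc e' univ act a (AlgPoints.map (S.M.map (homOfLE hN'Kc)) x')).hom.hom.hom P :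
          (fibreAt S Kc e' univ (AlgPoints.map (S.M.map (homOfLE hN'Kc)) x')).Points Ω) ∈ H) → ∃ β, Hβ β = H) ∧
      -- the `t₁`-translates are the roof neighbours through kernels meeting the `𝔭_{c•w}`-torsion in `H_β`
      (∀ β, ∃ Kβ : Subgroup ((fibreAt S Kc e' univ (AlgPoints.map (S.M.map (homOfLE hN'Kc)) x')).Points Ω),
        (∀ P, P ∈ Hβ β ↔ P ∈ Kβ ∧ IsIdealTorsionAt S Kc e' univ act (AlgPoints.map (S.M.map (homOfLE hN'Kc)) x')
            ((IsCMField.complexConj F) • w).asIdeal P) ∧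
        RoofAt S Kc e' univ act dual pol lvl pChar w.asIdeal (AlgPoints.map (S.M.map (homOfLE hN'Kc)) x')
          (AlgPoints.map (recordHeckeTranslateGS S hU7ₛ (rc₁ β) N' Kc (hrcN₁ β)) x') Kβ)

set_option maxHeartbeats 400000 in
/-- **`HeckeCentralRoofsAt … e′ N′ hN′Kc rc₂ hrcN₂ x′` — THE `t₂`-HALF of `HeckeRoofsAt`**: the central translates `T_{rc₂ β₂} x′` are roof neighbours of `ℓ x′` through the
whole `𝔭_{c•w}`-torsion — the last conjunct of `HeckeRoofsAt` VERBATIM (organ (O-R2), LA4-plan DEAL #20 «(H-E)-CENTRAL» re-typed at complex∕`Ω` points).  NOT asserted by declaring it.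
[cite: HarrisTaylorAMS2001, §III.4, pp. 108–110] [cite: RapoportSmithlingZhang2020Diagonal, §4.3 (4.23) p. 21] -/
def HeckeCentralRoofsAt {F : Type} [Field F] [NumberField F] [IsCMField F] {ι₁ : F →+* ℂ} {Jstar : Matrix (Fin 2) (Fin 2) F}
    {K₀ : C5.OpenCompactSubgroup ↥(finAdelic ↥(maximalRealSubfield F) F (IsCMField.complexConj F) 2 Jstar)}
    (S : RecordSystemGS F Jstar ι₁ K₀) (hU7ₛ : S.HeckeTranslateDefinedOver)
    (hJ : (Jstar.map (IsCMField.complexConj F))ᵀ = Jstar) (hJu : IsUnit Jstar)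
    {Fi : Type} [Field Fi] [Algebra F Fi] (Kc : C5.SmallLevel K₀)
    (w : HeightOneSpectrum (𝓞 F)) (hw : (IsCMField.complexConj F) • w ≠ w)
    (univ : Literature.AlgebraicGeometry.AbelianSchemes.AbelianSchemeOver ((Literature.AlgebraicGeometry.Motives.baseChange F Fi).obj (S.M.obj Kc)).left)
    (act : Literature.AlgebraicGeometry.AbelianSchemes.AbelianSchemeOver.RingAction (𝓞 F) univ)
    (dual : univ.DualPair) (pol : univ.Polarization dual) {g N : ℕ} (lvl : univ.LevelStructure g N) (pChar _fDeg : ℕ)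
    {Ω : Type} [Field Ω] [Algebra F Ω] (e' : Fi →ₐ[F] Ω) (N' : C5.SmallLevel K₀) (hN'Kc : N' ≤ Kc)
    (rc₂ : orbit (Kc.1.1 : Subgroup ↥(finAdelic ↥(maximalRealSubfield F) F (IsCMField.complexConj F) 2 Jstar))
         ((UnitaryGroup.heckeElementAt ↥(maximalRealSubfield F) F (IsCMField.complexConj F) 2 Jstar
             (⟨w, rfl⟩ : UnitaryGroup.PlacesOver F (w.under (𝓞 ↥(maximalRealSubfield F))))
             (IsCMField.complexConj_ne_one F) hJ hw (UnitaryGroup.isUnit_placeForm Jstar hJu w) (HeckeCharacter.uniformizer F w) 2 :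
           ↥(finAdelic ↥(maximalRealSubfield F) F (IsCMField.complexConj F) 2 Jstar)) :
           ↥(finAdelic ↥(maximalRealSubfield F) F (IsCMField.complexConj F) 2 Jstar) ⧸
             (Kc.1.1 : Subgroup ↥(finAdelic ↥(maximalRealSubfield F) F (IsCMField.complexConj F) 2 Jstar))) →
       ↥(finAdelic ↥(maximalRealSubfield F) F (IsCMField.complexConj F) 2 Jstar))
    (hrcN₂ : ∀ β, C5.HeckeLE (rc₂ β) N' Kc)
    (x' : AlgPoints (S.M.obj N') Ω) : Prop :=
    (∀ β₂, ∃ K₂ : Subgroup ((fibreAt S Kc e' univ (AlgPoints.map (S.M.map (homOfLE hN'Kc)) x')).Points Ω),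
        (∀ P, P ∈ K₂ ↔ IsIdealTorsionAt S Kc e' univ act (AlgPoints.map (S.M.map (homOfLE hN'Kc)) x')
            ((IsCMField.complexConj F) • w).asIdeal P) ∧
        RoofAt S Kc e' univ act dual pol lvl pChar w.asIdeal (AlgPoints.map (S.M.map (homOfLE hN'Kc)) x')
          (AlgPoints.map (recordHeckeTranslateGS S hU7ₛ (rc₂ β₂) N' Kc (hrcN₂ β₂)) x') K₂)

set_option maxHeartbeats 400000 in
/-- **`HeckeRoofsAt` FROM ITS TWO HALVES** — `HeckeLinesRoofsAt ∧ HeckeCentralRoofsAt → HeckeRoofsAt` (the conjuncts are the same terms; δ-unfold + anonymous constructor).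
[cite: HarrisTaylorAMS2001, §III.4, pp. 108–110] -/
theorem heckeRoofsAt_of_lines_of_central {F : Type} [Field F] [NumberField F] [IsCMField F] {ι₁ : F →+* ℂ} {Jstar : Matrix (Fin 2) (Fin 2) F}
    {K₀ : C5.OpenCompactSubgroup ↥(finAdelic ↥(maximalRealSubfield F) F (IsCMField.complexConj F) 2 Jstar)}
    (S : RecordSystemGS F Jstar ι₁ K₀) (hU7ₛ : S.HeckeTranslateDefinedOver)
    (hJ : (Jstar.map (IsCMField.complexConj F))ᵀ = Jstar) (hJu : IsUnit Jstar)
    {Fi : Type} [Field Fi] [Algebra F Fi] (Kc : C5.SmallLevel K₀)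
    (w : HeightOneSpectrum (𝓞 F)) (hw : (IsCMField.complexConj F) • w ≠ w)
    (univ : Literature.AlgebraicGeometry.AbelianSchemes.AbelianSchemeOver ((Literature.AlgebraicGeometry.Motives.baseChange F Fi).obj (S.M.obj Kc)).left)
    (act : Literature.AlgebraicGeometry.AbelianSchemes.AbelianSchemeOver.RingAction (𝓞 F) univ)
    (dual : univ.DualPair) (pol : univ.Polarization dual) {g N : ℕ} (lvl : univ.LevelStructure g N) (pChar fDeg : ℕ)
    {Ω : Type} [Field Ω] [Algebra F Ω] (e' : Fi →ₐ[F] Ω) (N' : C5.SmallLevel K₀) (hN'Kc : N' ≤ Kc)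
    (rc₁ : orbit (Kc.1.1 : Subgroup ↥(finAdelic ↥(maximalRealSubfield F) F (IsCMField.complexConj F) 2 Jstar))
         ((UnitaryGroup.heckeElementAt ↥(maximalRealSubfield F) F (IsCMField.complexConj F) 2 Jstar
             (⟨w, rfl⟩ : UnitaryGroup.PlacesOver F (w.under (𝓞 ↥(maximalRealSubfield F))))
             (IsCMField.complexConj_ne_one F) hJ hw (UnitaryGroup.isUnit_placeForm Jstar hJu w) (HeckeCharacter.uniformizer F w) 1 :
           ↥(finAdelic ↥(maximalRealSubfield F) F (IsCMField.complexConj F) 2 Jstar)) :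
           ↥(finAdelic ↥(maximalRealSubfield F) F (IsCMField.complexConj F) 2 Jstar) ⧸
             (Kc.1.1 : Subgroup ↥(finAdelic ↥(maximalRealSubfield F) F (IsCMField.complexConj F) 2 Jstar))) →
       ↥(finAdelic ↥(maximalRealSubfield F) F (IsCMField.complexConj F) 2 Jstar))
    (hrcN₁ : ∀ β, C5.HeckeLE (rc₁ β) N' Kc)
    (rc₂ : orbit (Kc.1.1 : Subgroup ↥(finAdelic ↥(maximalRealSubfield F) F (IsCMField.complexConj F) 2 Jstar))
         ((UnitaryGroup.heckeElementAt ↥(maximalRealSubfield F) F (IsCMField.complexConj F) 2 Jstar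
             (⟨w, rfl⟩ : UnitaryGroup.PlacesOver F (w.under (𝓞 ↥(maximalRealSubfield F))))
             (IsCMField.complexConj_ne_one F) hJ hw (UnitaryGroup.isUnit_placeForm Jstar hJu w) (HeckeCharacter.uniformizer F w) 2 :
           ↥(finAdelic ↥(maximalRealSubfield F) F (IsCMField.complexConj F) 2 Jstar)) :
           ↥(finAdelic ↥(maximalRealSubfield F) F (IsCMField.complexConj F) 2 Jstar) ⧸
             (Kc.1.1 : Subgroup ↥(finAdelic ↥(maximalRealSubfield F) F (IsCMField.complexConj F) 2 Jstar))) →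
       ↥(finAdelic ↥(maximalRealSubfield F) F (IsCMField.complexConj F) 2 Jstar))
    (hrcN₂ : ∀ β, C5.HeckeLE (rc₂ β) N' Kc)
    (x' : AlgPoints (S.M.obj N') Ω)
    (h₁ : HeckeLinesRoofsAt S hU7ₛ hJ hJu Kc w hw univ act dual pol lvl pChar fDeg e' N' hN'Kc rc₁ hrcN₁ x')
    (h₂ : HeckeCentralRoofsAt S hU7ₛ hJ hJu Kc w hw univ act dual pol lvl pChar fDeg e' N' hN'Kc rc₂ hrcN₂ x') :
    HeckeRoofsAt S hU7ₛ hJ hJu Kc w hw univ act dual pol lvl pChar fDeg e' N' hN'Kc rc₁ hrcN₁ rc₂ hrcN₂ x' := by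
  delta HeckeLinesRoofsAt at h₁
  delta HeckeCentralRoofsAt at h₂
  delta HeckeRoofsAt
  obtain ⟨Hβ, ha, hb, hc, hd⟩ := h₁
  exact ⟨Hβ, ha, hb, hc, hd, h₂⟩

set_option maxHeartbeats 400000 in
/-- **`HeckeRoofsE` FROM ITS POINTWISE FORM** — `HeckeRoofsE S …` is, by unfolding, `∀ e′ N′ hN′Kc rc₁ _ hrcN₁ rc₂ _ hrcN₂ x′, HeckeRoofsAt S … e′ N′ hN′Kc rc₁ hrcN₁ rc₂ hrcN₂ x′`
at `Ω := F̄_w` (the E-READINGS readers `fibreEOf`∕`actEOf`∕`lvlPtEOf`∕`IsIdealTorsionE`∕`RoofE` are the `Ω := F̄_w` instances of §1 on the nose). [cite: HarrisTaylorAMS2001, §III.4, pp. 108–110] -/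
theorem heckeRoofsE_of_forall_heckeRoofsAt {F : Type} [Field F] [NumberField F] [IsCMField F] {ι₁ : F →+* ℂ} {Jstar : Matrix (Fin 2) (Fin 2) F}
    {K₀ : C5.OpenCompactSubgroup ↥(finAdelic ↥(maximalRealSubfield F) F (IsCMField.complexConj F) 2 Jstar)}
    (S : RecordSystemGS F Jstar ι₁ K₀) (hU7ₛ : S.HeckeTranslateDefinedOver)
    (hJ : (Jstar.map (IsCMField.complexConj F))ᵀ = Jstar) (hJu : IsUnit Jstar)
    {Fi : Type} [Field Fi] [Algebra F Fi] (Kc : C5.SmallLevel K₀)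
    (w : HeightOneSpectrum (𝓞 F)) (hw : (IsCMField.complexConj F) • w ≠ w)
    (univ : Literature.AlgebraicGeometry.AbelianSchemes.AbelianSchemeOver ((Literature.AlgebraicGeometry.Motives.baseChange F Fi).obj (S.M.obj Kc)).left)
    (act : Literature.AlgebraicGeometry.AbelianSchemes.AbelianSchemeOver.RingAction (𝓞 F) univ)
    (dual : univ.DualPair) (pol : univ.Polarization dual) {g N : ℕ} (lvl : univ.LevelStructure g N) (pChar fDeg : ℕ)
    (h : ∀ (e' : Fi →ₐ[F] AlgebraicClosure (w.adicCompletion F)) (N' : C5.SmallLevel K₀) (hN'Kc : N' ≤ Kc)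
      (rc₁ : orbit (Kc.1.1 : Subgroup ↥(finAdelic ↥(maximalRealSubfield F) F (IsCMField.complexConj F) 2 Jstar))
           ((UnitaryGroup.heckeElementAt ↥(maximalRealSubfield F) F (IsCMField.complexConj F) 2 Jstar
               (⟨w, rfl⟩ : UnitaryGroup.PlacesOver F (w.under (𝓞 ↥(maximalRealSubfield F))))
               (IsCMField.complexConj_ne_one F) hJ hw (UnitaryGroup.isUnit_placeForm Jstar hJu w) (HeckeCharacter.uniformizer F w) 1 :
             ↥(finAdelic ↥(maximalRealSubfield F) F (IsCMField.complexConj F) 2 Jstar)) :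
             ↥(finAdelic ↥(maximalRealSubfield F) F (IsCMField.complexConj F) 2 Jstar) ⧸
               (Kc.1.1 : Subgroup ↥(finAdelic ↥(maximalRealSubfield F) F (IsCMField.complexConj F) 2 Jstar))) →
         ↥(finAdelic ↥(maximalRealSubfield F) F (IsCMField.complexConj F) 2 Jstar))
      (hrc₁ : ∀ β, ((rc₁ β : ↥(finAdelic ↥(maximalRealSubfield F) F (IsCMField.complexConj F) 2 Jstar)) :
          ↥(finAdelic ↥(maximalRealSubfield F) F (IsCMField.complexConj F) 2 Jstar) ⧸
            (Kc.1.1 : Subgroup ↥(finAdelic ↥(maximalRealSubfield F) F (IsCMField.complexConj F) 2 Jstar))) = β.1)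
      (hrcN₁ : ∀ β, C5.HeckeLE (rc₁ β) N' Kc)
      (rc₂ : orbit (Kc.1.1 : Subgroup ↥(finAdelic ↥(maximalRealSubfield F) F (IsCMField.complexConj F) 2 Jstar))
           ((UnitaryGroup.heckeElementAt ↥(maximalRealSubfield F) F (IsCMField.complexConj F) 2 Jstar
               (⟨w, rfl⟩ : UnitaryGroup.PlacesOver F (w.under (𝓞 ↥(maximalRealSubfield F))))
               (IsCMField.complexConj_ne_one F) hJ hw (UnitaryGroup.isUnit_placeForm Jstar hJu w) (HeckeCharacter.uniformizer F w) 2 :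
             ↥(finAdelic ↥(maximalRealSubfield F) F (IsCMField.complexConj F) 2 Jstar)) :
             ↥(finAdelic ↥(maximalRealSubfield F) F (IsCMField.complexConj F) 2 Jstar) ⧸
               (Kc.1.1 : Subgroup ↥(finAdelic ↥(maximalRealSubfield F) F (IsCMField.complexConj F) 2 Jstar))) →
         ↥(finAdelic ↥(maximalRealSubfield F) F (IsCMField.complexConj F) 2 Jstar))
      (hrc₂ : ∀ β, ((rc₂ β : ↥(finAdelic ↥(maximalRealSubfield F) F (IsCMField.complexConj F) 2 Jstar)) :
          ↥(finAdelic ↥(maximalRealSubfield F) F (IsCMField.complexConj F) 2 Jstar) ⧸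
            (Kc.1.1 : Subgroup ↥(finAdelic ↥(maximalRealSubfield F) F (IsCMField.complexConj F) 2 Jstar))) = β.1)
      (hrcN₂ : ∀ β, C5.HeckeLE (rc₂ β) N' Kc)
      (x' : AlgPoints (S.M.obj N') (AlgebraicClosure (w.adicCompletion F))),
      HeckeRoofsAt S hU7ₛ hJ hJu Kc w hw univ act dual pol lvl pChar fDeg e' N' hN'Kc rc₁ hrcN₁ rc₂ hrcN₂ x') :
    HeckeRoofsE S hU7ₛ hJ hJu Kc w hw univ act dual pol lvl pChar fDeg := by
  intro e' N' hN'Kc rc₁ hrc₁ hrcN₁ rc₂ hrc₂ hrcN₂ x'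
  have h1 : HeckeRoofsAt S hU7ₛ hJ hJu Kc w hw univ act dual pol lvl pChar fDeg e' N' hN'Kc rc₁ hrcN₁ rc₂ hrcN₂ x' :=
    h e' N' hN'Kc rc₁ hrc₁ hrcN₁ rc₂ hrc₂ hrcN₂ x'
  -- both sides are the SAME expression once the twin readers are δ-unfolded (the §1 bodies are the E-READINGS bodies with `F̄_w ↦ Ω`)
  delta HeckeRoofsAt RoofAt IsIdealTorsionAt actAt lvlPtAt polAt dualAt fibreAt schAt at h1
  delta RoofE IsIdealTorsionE actEOf lvlPtEOf polEOf dualEOf fibreEOf schEOf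
  exact h1

/-! ### §2 THE ORGANS of skeleton v1 — `stub_EC` (complex side) and `stub_ET` (transport `ℂ ↝ F̄_w`) -/

/-- An `F`-ALGEBRA HOM from a ring hom compatible with the structure maps (bookkeeping). [cite: Lang2002, Ch. V §2 Thm. 2.8] -/
def algHomOfRingHom {F Ω Ω' : Type} [Field F] [Field Ω] [Field Ω'] [Algebra F Ω] [Algebra F Ω'] (φ : Ω →+* Ω')
    (h : ∀ x : F, φ (algebraMap F Ω x) = algebraMap F Ω' x) : Ω →ₐ[F] Ω' :=
  AlgHom.mk φ h

/-- **THE SHEET `τE♯ : Fi →ₐ[F] ℂ`** — the chart՚s complex embedding `τE` as an `F`-algebra map for `ℂ` regarded as an `F`-algebra THROUGH `ι₁` (from `τE ∘ (F → Fᵢ) = ι₁`).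
[cite: Lang2002, Ch. V §2 Thm. 2.8] -/
def sheetHom {F Fi : Type} [Field F] [Field Fi] [Algebra F Fi] (ι₁ : F →+* ℂ) (τE : Fi →+* ℂ) (hτE : τE.comp (algebraMap F Fi) = ι₁) :
    letI : Algebra F ℂ := ι₁.toAlgebra
    Fi →ₐ[F] ℂ :=
  letI : Algebra F ℂ := ι₁.toAlgebra
  algHomOfRingHom τE fun x => RingHom.congr_fun hτE x

/-- **`σ♯ : F̄_w →ₐ[F] ℂ`** — a ring isomorphism `σ : F̄_w ≃+* ℂ` with `σ ∘ e′ = τE` on `Fᵢ` is an `F`-algebra map for `ℂ` through `ι₁` (since `e′` is `F`-linear and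
`τE ∘ (F → Fᵢ) = ι₁`). [cite: Lang2002, Ch. VIII §1 and Ch. V §2 Thm. 2.8] -/
def sigmaHom {F Fi : Type} [Field F] [NumberField F] [Field Fi] [Algebra F Fi] (ι₁ : F →+* ℂ) (τE : Fi →+* ℂ) (hτE : τE.comp (algebraMap F Fi) = ι₁)
    (w : HeightOneSpectrum (𝓞 F)) (σ : AlgebraicClosure (w.adicCompletion F) ≃+* ℂ) (e' : Fi →ₐ[F] AlgebraicClosure (w.adicCompletion F))
    (hσe : ∀ x : Fi, σ (e' x) = τE x) :
    letI : Algebra F ℂ := ι₁.toAlgebra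
    AlgebraicClosure (w.adicCompletion F) →ₐ[F] ℂ :=
  letI : Algebra F ℂ := ι₁.toAlgebra
  algHomOfRingHom (σ : AlgebraicClosure (w.adicCompletion F) →+* ℂ) fun x => by
    show σ (algebraMap F (AlgebraicClosure (w.adicCompletion F)) x) = ι₁ x
    rw [← e'.commutes x, hσe, ← hτE]
    rfl

/-- **THE MOVED POINT `φ_* y := (Spec φ ≫ y, ·)`** of an `F`-scheme along an `F`-algebra map of coefficient fields (★ `specMap_comp_algPoints_hom` is the structure square).
[cite: GortzWedhorn2020, Section (4.8)–(4.9)] -/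
def movePt {F Ω Ω' : Type} [Field F] [Field Ω] [Field Ω'] [Algebra F Ω] [Algebra F Ω'] (φ : Ω →ₐ[F] Ω') (X : SchemeOver F) (y : AlgPoints X Ω) :
    AlgPoints X Ω' :=
  AlgPoints.mk (Spec.map (CommRingCat.ofHom φ.toRingHom) ≫ y.left) (Literature.AlgebraicGeometry.Motives.specMap_comp_algPoints_hom φ X y)

set_option maxHeartbeats 400000 in
/-! ### §2b JUNCTION LEMMAS (PROVED) — the sheet point of a complex point, its flat point, the Shimura classes of `ℓ x′` and `T_g x′`, the L6 reading AT the sheet point -/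

/-- **The sheet point `ℓ_{τE♯} y` AS A COMPLEX POINT OF `X := (S.M Kc) ⊗_F Fᵢ` ALONG `τE`** (the L6 `Reads` currency): underlying morphism `(y, Spec τE)` (★ `thickeningLift`).
[cite: GortzWedhorn2020, Section (4.8)–(4.9)] -/
def sheetPt {F Fi : Type} [Field F] [NumberField F] [IsCMField F] [Field Fi] [Algebra F Fi] (ι₁ : F →+* ℂ) (τE : Fi →+* ℂ)
    (hτE : τE.comp (algebraMap F Fi) = ι₁) {Jstar : Matrix (Fin 2) (Fin 2) F}
    {K₀ : C5.OpenCompactSubgroup ↥(finAdelic ↥(maximalRealSubfield F) F (IsCMField.complexConj F) 2 Jstar)}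
    (S : RecordSystemGS F Jstar ι₁ K₀) (Kc : C5.SmallLevel K₀)
    (y : letI : Algebra F ℂ := ι₁.toAlgebra; AlgPoints (S.M.obj Kc) ℂ) :
    letI : Algebra Fi ℂ := τE.toAlgebra
    ComplexPoints ((Literature.AlgebraicGeometry.Motives.baseChange F Fi).obj (S.M.obj Kc)) :=
  letI : Algebra Fi ℂ := τE.toAlgebra
  letI : Algebra F ℂ := ι₁.toAlgebra
  AlgPoints.mk (thickeningLift (sheetHom ι₁ τE hτE) (S.M.obj Kc) y).left (by
    change (thickeningLift (sheetHom ι₁ τE hτE) (S.M.obj Kc) y).left ≫ pullback.snd (S.M.obj Kc).hom (bcSpec F Fi) = _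
    rw [Literature.AlgebraicGeometry.Motives.thickeningLift_left_comp_snd]
    rfl)

/-- `(ℓ y).left = (thickeningLift τE♯ y).left` (`rfl`). [cite: GortzWedhorn2020, Section (4.8)–(4.9)] -/
theorem sheetPt_left {F Fi : Type} [Field F] [NumberField F] [IsCMField F] [Field Fi] [Algebra F Fi] (ι₁ : F →+* ℂ) (τE : Fi →+* ℂ)
    (hτE : τE.comp (algebraMap F Fi) = ι₁) {Jstar : Matrix (Fin 2) (Fin 2) F}
    {K₀ : C5.OpenCompactSubgroup ↥(finAdelic ↥(maximalRealSubfield F) F (IsCMField.complexConj F) 2 Jstar)}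
    (S : RecordSystemGS F Jstar ι₁ K₀) (Kc : C5.SmallLevel K₀)
    (y : letI : Algebra F ℂ := ι₁.toAlgebra; AlgPoints (S.M.obj Kc) ℂ) :
    (sheetPt ι₁ τE hτE S Kc y).left = (letI : Algebra F ℂ := ι₁.toAlgebra; (thickeningLift (sheetHom ι₁ τE hτE) (S.M.obj Kc) y).left) := rfl

/-- **The flat point under `ℓ y` is `y`**: `y.left = (ℓ y).left ≫ pr₁` (★ `thickeningLift_left_comp_fst`) — the `Pflat` hypothesis of L6 `Reads` at `x := ℓ y`.
[cite: GortzWedhorn2020, Section (4.7)–(4.9)] -/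
theorem flat_sheetPt {F Fi : Type} [Field F] [NumberField F] [IsCMField F] [Field Fi] [Algebra F Fi] (ι₁ : F →+* ℂ) (τE : Fi →+* ℂ)
    (hτE : τE.comp (algebraMap F Fi) = ι₁) {Jstar : Matrix (Fin 2) (Fin 2) F}
    {K₀ : C5.OpenCompactSubgroup ↥(finAdelic ↥(maximalRealSubfield F) F (IsCMField.complexConj F) 2 Jstar)}
    (S : RecordSystemGS F Jstar ι₁ K₀) (Kc : C5.SmallLevel K₀)
    (y : letI : Algebra F ℂ := ι₁.toAlgebra; AlgPoints (S.M.obj Kc) ℂ) :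
    (letI : Algebra F ℂ := ι₁.toAlgebra; y.left) = (sheetPt ι₁ τE hτE S Kc y).left ≫ pullback.fst (S.M.obj Kc).hom (bcSpec F Fi) := by
  letI : Algebra F ℂ := ι₁.toAlgebra
  rw [sheetPt_left]
  exact (Literature.AlgebraicGeometry.Motives.thickeningLift_left_comp_fst (sheetHom ι₁ τE hτE) (S.M.obj Kc) y).symm

/-- **The Shimura class of `ℓ_{N′→Kc} x′`**: `pts_{Kc} (ℓ x′) = [v, a]_{Kc}` if `pts_{N′} x′ = [v, a]_{N′}` (record field `map_pts`). [cite: Deligne1979ShimuraVarieties, 2.1.4] -/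
theorem pts_map_homOfLE {F : Type} [Field F] [NumberField F] [IsCMField F] (ι₁ : F →+* ℂ) {Jstar : Matrix (Fin 2) (Fin 2) F}
    {K₀ : C5.OpenCompactSubgroup ↥(finAdelic ↥(maximalRealSubfield F) F (IsCMField.complexConj F) 2 Jstar)}
    (S : RecordSystemGS F Jstar ι₁ K₀) (N' Kc : C5.SmallLevel K₀) (hN'Kc : N' ≤ Kc)
    (x' : letI : Algebra F ℂ := ι₁.toAlgebra; AlgPoints (S.M.obj N') ℂ)
    (v : Fin 2 → ℂ) (hv : v ∈ negCone (Jstar.map ι₁)) (a : ↥(finAdelic ↥(maximalRealSubfield F) F (IsCMField.complexConj F) 2 Jstar))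
    (hx : letI : Algebra F ℂ := ι₁.toAlgebra; S.pts N' x' = ShimuraSetGS.mk F Jstar ι₁ N'.1.1 v hv a) :
    letI : Algebra F ℂ := ι₁.toAlgebra
    S.pts Kc (AlgPoints.map (S.M.map (homOfLE hN'Kc)) x') = ShimuraSetGS.mk F Jstar ι₁ Kc.1.1 v hv a := by
  letI : Algebra F ℂ := ι₁.toAlgebra
  have h := S.map_pts N' Kc (homOfLE hN'Kc) v hv a
  rw [← hx, Homeomorph.symm_apply_apply] at h
  exact h

/-- **The Shimura class of the Hecke translate `T_g x′`**: `pts_{Kc} (T_g x′) = [v, a·g]_{Kc}` if `pts_{N′} x′ = [v, a]_{N′}` (u1 `hU7ₛ`, ★ `isHeckeTranslate_recordHeckeTranslateGS`).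
[cite: Milne2005ShimuraVarieties, Thm. 13.6 p. 118] -/
theorem pts_map_recordHeckeTranslateGS {F : Type} [Field F] [NumberField F] [IsCMField F] (ι₁ : F →+* ℂ) {Jstar : Matrix (Fin 2) (Fin 2) F}
    {K₀ : C5.OpenCompactSubgroup ↥(finAdelic ↥(maximalRealSubfield F) F (IsCMField.complexConj F) 2 Jstar)}
    (S : RecordSystemGS F Jstar ι₁ K₀) (hU7ₛ : S.HeckeTranslateDefinedOver)
    (g : ↥(finAdelic ↥(maximalRealSubfield F) F (IsCMField.complexConj F) 2 Jstar)) (N' Kc : C5.SmallLevel K₀) (hK : C5.HeckeLE g N' Kc)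
    (x' : letI : Algebra F ℂ := ι₁.toAlgebra; AlgPoints (S.M.obj N') ℂ)
    (v : Fin 2 → ℂ) (hv : v ∈ negCone (Jstar.map ι₁)) (a : ↥(finAdelic ↥(maximalRealSubfield F) F (IsCMField.complexConj F) 2 Jstar))
    (hx : letI : Algebra F ℂ := ι₁.toAlgebra; S.pts N' x' = ShimuraSetGS.mk F Jstar ι₁ N'.1.1 v hv a) :
    letI : Algebra F ℂ := ι₁.toAlgebra
    S.pts Kc (AlgPoints.map (recordHeckeTranslateGS S hU7ₛ g N' Kc hK) x') = ShimuraSetGS.mk F Jstar ι₁ Kc.1.1 v hv (a * g) := by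
  letI : Algebra F ℂ := ι₁.toAlgebra
  have h := isHeckeTranslate_recordHeckeTranslateGS S hU7ₛ g N' Kc hK v hv a
  rw [← hx, Homeomorph.symm_apply_apply] at h
  exact h

set_option maxHeartbeats 400000 in
/-- **THE L6 READING AT THE SHEET POINT `ℓ y`** — `RingActionReading C ε ρ` (L6 `Reads`, ∃-representative form) specialised at `x := ℓ y`, `Pflat := y`: a representative
`(v, a)` of `pts y`, and for every principal representative `(u, r)` of `C.piece a` an ADMISSIBLE marking `m` of the fibre `P.A_{ℓ y}` by `[J(C.Z a v), r]` reading the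
level structure, with `m.γ = 1`, `m.Ψ = Π_{C.Z a v}`, through which `ρ` reads as `C.Mρ a`.  (`P.A.fibre (ℓ y).left` is `fibreAt S Kc τE♯ P.A y` ON THE NOSE.)
[cite: Kottwitz1992, §5 (p. 390)] [cite: Lange2023AbelianVarietiesComplex, §3.4 Proposition 3.4.1] -/
theorem reads_sheetPt {F Fi : Type} [Field F] [NumberField F] [IsCMField F] [Field Fi] [NumberField Fi] [Algebra F Fi] (ι₁ : F →+* ℂ)
    (τE : Fi →+* ℂ) (hτE : τE.comp (algebraMap F Fi) = ι₁) {Jstar : Matrix (Fin 2) (Fin 2) F}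
    {K₀ : C5.OpenCompactSubgroup (GSAdele F Jstar)} {S : RecordSystemGS F Jstar ι₁ K₀} {Kc : C5.SmallLevel K₀} {Φ : Set (F →+* ℂ)}
    (C : AuxChartGS F ι₁ Jstar K₀ S Kc Fi τE Φ)
    (ε : (Literature.AlgebraicGeometry.Motives.baseChange F Fi).obj (S.M.obj Kc) ⟶
        (Literature.AlgebraicGeometry.Motives.baseChange ℚ Fi).obj C.𝓜.M)
    (ρ : AbelianSchemeOver.RingAction (𝓞 F) (C.𝓜.univ.baseChange (ε.left ≫ pullback.fst C.𝓜.M.hom (bcSpec ℚ Fi))).A)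
    (hR : RingActionReading C ε ρ) (y : letI : Algebra F ℂ := ι₁.toAlgebra; AlgPoints (S.M.obj Kc) ℂ) :
    letI P := C.𝓜.univ.baseChange (ε.left ≫ pullback.fst C.𝓜.M.hom (bcSpec ℚ Fi))
    letI : Algebra Fi ℂ := τE.toAlgebra
    letI x := sheetPt ι₁ τE hτE S Kc y
    ∃ (v : Fin 2 → ℂ) (hv : v ∈ negCone (Jstar.map ι₁)) (a : GSAdele F Jstar),
      (letI : Algebra F ℂ := ι₁.toAlgebra; S.pts Kc y) = ShimuraSetGS.mk F Jstar ι₁ Kc.1.1 v hv a ∧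
      ∀ (u : finAdeleQˣ) (r : gspFinAdelic C.δ),
        (∀ w, Valued.v ((u : finAdeleQ) w) = 1) →
        (u : finAdeleQ) - ((C.piece a : ZMod C.N).val : ℕ) ∈ levelIdeal C.N →
        r ∈ principalLevelSubgroup C.δ 1 →
        IsMultiplier (typeFormOver C.δ finAdeleQ) (r : GL (Fin C.g ⊕ Fin C.g) finAdeleQ) u →
        ((r : GL (Fin C.g ⊕ Fin C.g) finAdeleQ) : Matrix (Fin C.g ⊕ Fin C.g) (Fin C.g ⊕ Fin C.g) finAdeleQ) =
          Matrix.fromBlocks 1 0 0 ((u : finAdeleQ) • (1 : Matrix (Fin C.g) (Fin C.g) finAdeleQ)) →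
        ∃ (m : SiegelAdelicMarking ⟨SiegelModuli.jOfSiegel C.δ (C.Z a v),
              SiegelComplexRecordSystem.jOfSiegel_mem_C0pm C.hδ.1 (C.Z_mem a v hv)⟩ r (P.A.fibre x.left).toAbelianVariety)
          (Θ : Literature.AlgebraicGeometry.Motives.CartierDivisor (P.A.fibre x.left).toAbelianVariety.X.left)
          (Λ : P.level.SymplecticLift x.left Θ C.δ),
          Θ.IsAmple ∧ P.A.IsLambdaOfAt x.left P.D P.pol.lam Θ ∧
          (∀ ⦃M : ℕ⦄, C.N ∣ M → M ≠ 0 → ∀ (y' : Fin C.g ⊕ Fin C.g → ZMod M) (w : Fin C.g ⊕ Fin C.g → ℚ),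
            AdelicCongr ((r⁻¹ : gspFinAdelic C.δ) : GL (Fin C.g ⊕ Fin C.g) finAdeleQ) 1 w (fun i => ((y' i).val : ℚ) / M) →
              ((Λ.lift M (Multiplicative.ofAdd y')) : (P.A.fibre x.left).toAbelianVariety.Points ℂ) = m.r w) ∧
          m.γ = 1 ∧ (∀ w : Fin C.g ⊕ Fin C.g → ℝ, m.Ψ w = siegelPeriodMap C.δ (C.Z a v) w) ∧
          ∀ (b : 𝓞 F) (t : ComplexTorus m.Ψ),
            haveI := ρ.isMonHom b
            AlgPoints.map (AbelianSchemeOver.fibreHom (ρ.i b) x.left).hom.hom.hom (m.toFun t) =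
              m.toFun (ComplexTorus.mapMatrix m.Ψ m.Ψ (C.Mρ a b) t) :=
  hR (sheetPt ι₁ τE hτE S Kc y) y (flat_sheetPt ι₁ τE hτE S Kc y)

end Summit.HodgeConjecture.HodgeConjecture.Cruxes.HLiu418.F0P6aStubEHECKE
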